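import Literature.Analysis.Distribution.RadialSliceProfiles
import Literature.MathematicalPhysics.QuantumFieldTheory.SchwartzTensorGeometricNorms
import Literature.MathematicalPhysics.QuantumLattice.SchwartzPartition
import Literature.Analysis.FunctionSpaces.SchwartzCompEquivBound
import HarnessLib

/-!
# The real slices of product radial kernels on `ℂᵈ` as profiles on `ℝᵈ`, with geometric seminorm bounds

Topic `Literature/MathematicalPhysics/QuantumFieldTheory`; support file (all proved; the profiles
as definitions; no named facts) for the temperedness estimate (4.5) of Osterwalder–Schrader II
(Comm. Math. Phys. 42 (1975), Thm. 4.1) **with exponent linear in the number of points and constants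
of factorial growth** (Ch. VI.1, (6.4)–(6.7) and (6.12), (6.17)): the pointwise value of a
real-analytic Schwinger function is an exact average of its continuation over a small polydisc
(`Literature/Analysis/Complex/PolydiscWeightedMeanValue`) against the product radial kernel
`∏_{j,μ} β(|w_{jμ}|² − r)` (`β = adaptedBump n r` of order `n ≍ ks`); at fixed imaginary parts
`y` its real slice factorises over the points `j` into the **profiles** of this file,

  `prodProfile n r y (x) = ∏_μ β(x_μ² + y_μ² − r)`   on `ℝᵈ = EuclideanSpace ℝ (Fin d)`,

which are the test-function profiles through which E0' is applied. Their properties: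

* `prodProfile_apply`; support in the closed Euclidean ball of radius `√(2dr)`
  (`tsupport_prodProfile_subset`), nonnegativity;
* `seminorm_prodProfile_le` — **geometric seminorm bounds uniform in `y`**:
  `p_{k,l}(prodProfile) ≤ (2 ((n+1)/r))ᵈ (2√d)ᵏ (6 d (n+1) max(1, (n+1)A/r))ˡ` for `k, l ≤ n`, the form
  consumed by `schwartzNorm_tensorFin_le_geometric` at the level of the points.

## References

* K. Osterwalder, R. Schrader, *Axioms for Euclidean Green's functions II*, Comm. Math. Phys. 42
  (1975) 281–305, Ch. VI.1 (6.4)–(6.7), (6.12), (6.17). [OsterwalderSchraderCMP1975]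
-/

noncomputable section

open Set Metric Function
open scoped SchwartzMap

namespace Literature.MathematicalPhysics.QuantumFieldTheory

open Literature.Analysis.Distribution Literature.Analysis.FunctionSpaces
open Literature.MathematicalPhysics.QuantumLattice (schwartzNorm)

variable {d : ℕ}

/-! ### The complex-valued slices -/

/-- The slice `x ↦ β(x² + c)` as a complex-valued Schwartz function. [folklore] -/
def sliceFnSC (n : ℕ) {r : ℝ} (hr : 0 < r) (c : ℝ) : 𝓢(ℝ, ℂ) :=
  ((hasCompactSupport_sliceFn n hr c).comp_left Complex.ofReal_zero).toSchwartzMap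
    (QuantumLattice.contDiff_ofReal_comp ℂ (contDiff_sliceFn n r c))

/-- Values of the complex slice. [folklore] -/
@[simp] theorem sliceFnSC_apply (n : ℕ) {r : ℝ} (hr : 0 < r) (c x : ℝ) : sliceFnSC n hr c x = (sliceFn n r c x : ℂ) := rfl

/-- **Seminorms of the complex slices** (equal to the real ones). [folklore] -/
theorem seminorm_sliceFnSC_le (n : ℕ) {r : ℝ} (hr : 0 < r) (hr1 : r ≤ 1) {c : ℝ} (hc : -r ≤ c) (k : ℕ) {m : ℕ} (hm : m ≤ n) :
    SchwartzMap.seminorm ℝ k m (sliceFnSC n hr c) ≤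
      ((n : ℝ) + 1) / r * 2 ^ k * (6 * ((n : ℝ) + 1) * max 1 (((n : ℝ) + 1) / r * baseDerivL1)) ^ m := by
  refine SchwartzMap.seminorm_le_bound ℝ k m _ (by have := baseDerivL1_nonneg; have := adaptedBump_ratio_pos n hr; positivity)
    fun x => ?_
  have hnorm : ‖iteratedFDeriv ℝ m (⇑(sliceFnSC n hr c)) x‖ = ‖iteratedFDeriv ℝ m (sliceFn n r c) x‖ :=
    QuantumLattice.norm_iteratedFDeriv_ofReal_comp ℂ (contDiff_sliceFn n r c) m x
  rw [hnorm]
  have h := SchwartzMap.le_seminorm ℝ k m (sliceFnS n hr c) x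
  exact h.trans (seminorm_sliceFnS_le n hr hr1 hc k hm)

/-! ### The product profiles on `ℝᵈ` -/

/-- **The product profile** `x ↦ ∏_μ β(x_μ² + y_μ² − r)` on `EuclideanSpace ℝ (Fin d)` (the real
slice at imaginary parts `y` of the product radial kernel `∏_μ β(|w_μ|² − r)`). [cite: OsterwalderSchraderCMP1975, Ch. VI.1 (6.5)] -/
def prodProfile (n : ℕ) {r : ℝ} (hr : 0 < r) (y : Fin d → ℝ) : 𝓢(EuclideanSpace ℝ (Fin d), ℂ) :=
  SchwartzMap.compCLMOfContinuousLinearEquiv ℝ (EuclideanSpace.equiv (Fin d) ℝ)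
    (SchwartzMap.tensorFin d fun μ => sliceFnSC n hr (y μ ^ 2 - r))

/-- Values of the product profile. [folklore] -/
theorem prodProfile_apply (n : ℕ) {r : ℝ} (hr : 0 < r) (y : Fin d → ℝ) (x : EuclideanSpace ℝ (Fin d)) :
    prodProfile n hr y x = ∏ μ, ((sliceFn n r (y μ ^ 2 - r) (x μ) : ℝ) : ℂ) := by
  simp [prodProfile, SchwartzMap.tensorFin_apply]

/-- **Support of the product profile**: a nonzero value forces `x_μ² ≤ 2r − y_μ²` for every `μ`. [folklore] -/
theorem sq_le_of_prodProfile_ne_zero (n : ℕ) {r : ℝ} (hr : 0 < r) {y : Fin d → ℝ} {x : EuclideanSpace ℝ (Fin d)}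
    (hx : prodProfile n hr y x ≠ 0) (μ : Fin d) : x μ ^ 2 ≤ 2 * r - y μ ^ 2 := by
  rw [prodProfile_apply] at hx
  have hμ : ((sliceFn n r (y μ ^ 2 - r) (x μ) : ℝ) : ℂ) ≠ 0 := fun h => hx (Finset.prod_eq_zero (Finset.mem_univ μ) h)
  have h := sq_le_of_sliceFn_ne_zero n hr (x := x μ) (c := y μ ^ 2 - r) (by exact_mod_cast hμ)
  linarith

/-- **The product profile is supported in the Euclidean ball of radius `√(2dr)`.** [folklore] -/
theorem tsupport_prodProfile_subset (n : ℕ) {r : ℝ} (hr : 0 < r) (y : Fin d → ℝ) :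
    tsupport (prodProfile n hr y : EuclideanSpace ℝ (Fin d) → ℂ) ⊆ Metric.closedBall 0 (Real.sqrt (2 * d * r)) := by
  refine closure_minimal (fun x hx => ?_) isClosed_closedBall
  have h := sq_le_of_prodProfile_ne_zero n hr (mem_support.1 hx)
  rw [mem_closedBall, dist_zero_right, EuclideanSpace.norm_eq]
  refine Real.sqrt_le_sqrt ?_
  calc ∑ μ, ‖x μ‖ ^ 2 = ∑ μ, x μ ^ 2 := Finset.sum_congr rfl fun μ _ => by rw [Real.norm_eq_abs, sq_abs]
    _ ≤ ∑ _μ : Fin d, 2 * r := Finset.sum_le_sum fun μ _ => (h μ).trans (by nlinarith)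
    _ = 2 * d * r := by simp; ring

/-! ### Geometric seminorm bounds -/

/-- Operator norm of `EuclideanSpace.equiv`: `‖x‖_∞ ≤ ‖x‖₂`. [folklore] -/
theorem norm_euclideanSpace_equiv_le : ‖((EuclideanSpace.equiv (Fin d) ℝ : EuclideanSpace ℝ (Fin d) ≃L[ℝ] (Fin d → ℝ)) :
    EuclideanSpace ℝ (Fin d) →L[ℝ] (Fin d → ℝ))‖ ≤ 1 := by
  refine ContinuousLinearMap.opNorm_le_bound _ zero_le_one fun x => ?_
  rw [one_mul, pi_norm_le_iff_of_nonneg (norm_nonneg _)]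
  intro μ
  exact PiLp.norm_apply_le x μ

/-- Operator norm of the inverse: `‖x‖₂ ≤ √d ‖x‖_∞`. [folklore] -/
theorem norm_euclideanSpace_equiv_symm_le : ‖(((EuclideanSpace.equiv (Fin d) ℝ).symm : (Fin d → ℝ) ≃L[ℝ] EuclideanSpace ℝ (Fin d)) :
    (Fin d → ℝ) →L[ℝ] EuclideanSpace ℝ (Fin d))‖ ≤ Real.sqrt d := by
  refine ContinuousLinearMap.opNorm_le_bound _ (Real.sqrt_nonneg _) fun x => ?_
  have h := QuantumLattice.EuclideanSpace.norm_le_sqrt_card_mul ((EuclideanSpace.equiv (Fin d) ℝ).symm x) (norm_nonneg x)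
    fun μ => by
      rw [← Real.norm_eq_abs]
      exact norm_le_pi_norm x μ
  simpa using h

/-- **Geometric seminorm bounds of the product profiles, uniformly in `y`** (`0 < r ≤ 1`; the slice
parameters `c_μ = y_μ² − r ≥ −r` automatically): for `k, l ≤ n`,
`p_{k,l}(prodProfile) ≤ (2 (n+1)/r)ᵈ (2√d)ᵏ (6 d (n+1) max(1,(n+1)A/r))ˡ`. [cite: OsterwalderSchraderCMP1975, Ch. VI.1 (6.12), (6.17)] -/
theorem seminorm_prodProfile_le (n : ℕ) {r : ℝ} (hr : 0 < r) (hr1 : r ≤ 1) (y : Fin d → ℝ)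
    {k l : ℕ} (hk : k ≤ n) (hl : l ≤ n) :
    SchwartzMap.seminorm ℝ k l (prodProfile n hr y) ≤
      (2 * (((n : ℝ) + 1) / r)) ^ d * (2 * Real.sqrt d) ^ k *
        ((d : ℝ) * (6 * ((n : ℝ) + 1) * max 1 (((n : ℝ) + 1) / r * baseDerivL1))) ^ l := by
  set a : ℝ := ((n : ℝ) + 1) / r with ha
  set B : ℝ := 6 * ((n : ℝ) + 1) * max 1 (((n : ℝ) + 1) / r * baseDerivL1) with hB
  have ha0 : 0 < a := adaptedBump_ratio_pos n hr
  have hB0 : 0 ≤ B := by have := baseDerivL1_nonneg; positivity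
  -- the tensor product over the coordinates
  have htens := seminorm_tensorFin_le_geometric (E := ℝ) (fun μ => sliceFnSC n hr (y μ ^ 2 - r)) (M := n) (R := 2) (B := B)
    (by norm_num) hB0 (fun _ => a) (fun _ => ha0.le)
    (fun μ k' hk' i hi => by
      have hc : -r ≤ y μ ^ 2 - r := by nlinarith
      have h := seminorm_sliceFnSC_le n hr hr1 hc k' hi
      rw [← ha, ← hB] at h
      exact h) k hk l hl
  -- composition with the coordinate equivalence
  have hcomp := seminorm_compCLMOfContinuousLinearEquiv_le (EuclideanSpace.equiv (Fin d) ℝ)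
    (SchwartzMap.tensorFin d fun μ => sliceFnSC n hr (y μ ^ 2 - r)) k l
  refine hcomp.trans ?_
  have h1 : ‖(((EuclideanSpace.equiv (Fin d) ℝ).symm : (Fin d → ℝ) ≃L[ℝ] EuclideanSpace ℝ (Fin d)) :
      (Fin d → ℝ) →L[ℝ] EuclideanSpace ℝ (Fin d))‖ ^ k ≤ Real.sqrt d ^ k :=
    pow_le_pow_left₀ (norm_nonneg _) norm_euclideanSpace_equiv_symm_le k
  have h2 : ‖((EuclideanSpace.equiv (Fin d) ℝ : EuclideanSpace ℝ (Fin d) ≃L[ℝ] (Fin d → ℝ)) :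
      EuclideanSpace ℝ (Fin d) →L[ℝ] (Fin d → ℝ))‖ ^ l ≤ 1 := pow_le_one₀ (norm_nonneg _) norm_euclideanSpace_equiv_le
  calc _ ≤ Real.sqrt d ^ k * 1 * (2 ^ d * (∏ _μ : Fin d, a) * 2 ^ k * (d * B) ^ l) :=
        mul_le_mul (mul_le_mul h1 h2 (by positivity) (by positivity)) htens (apply_nonneg _ _) (by positivity)
    _ = (2 * a) ^ d * (2 * Real.sqrt d) ^ k * ((d : ℝ) * B) ^ l := by
        rw [Finset.prod_const, Finset.card_univ, Fintype.card_fin, mul_pow, mul_pow 2 (Real.sqrt d)]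
        ring

end Literature.MathematicalPhysics.QuantumFieldTheory
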